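import Summits.FinalStateConjecture.FinalStateConjecture.Theorems.BartnikGapSettlingGapExhaustionIKLocalStepTFarOfConstants
import Summits.FinalStateConjecture.FinalStateConjecture.Theorems.BartnikGapSettlingGapExhaustionFarConditionalSweep
import Summits.FinalStateConjecture.FinalStateConjecture.Theorems.BartnikGapSettlingGapExhaustionFarPointMultiplier
import Summits.FinalStateConjecture.FinalStateConjecture.Theorems.BartnikGapSettlingGapExhaustionKerrFarBandRegularity
import Summits.FinalStateConjecture.FinalStateConjecture.Theorems.BartnikGapSettlingGapExhaustionIKStepFrameUniform
import HarnessLib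

/-!
# Crux `GapExhaustion` (stmt-FinalStateConjecture-10808), line `photon-shell-pseudoconvexity`:
# `farChartExtension` — the FAR completion of the `T`-conditional sweep at the chart level:
# in a stationary chart weighted-close to Kerr, a `∂₀`-commuting coordinate Killing field on the
# collar `{C M/2 < r < C M}` extends to `{r > C M/2}`, with UNIVERSAL constants

Route `BartnikGapSettling`; helper (`--supports stmt-FinalStateConjecture-10808`) of line lead
c12 (far chain, assembly). Composes the scale-free far local step (V-6T-far
`ikLocalStepTFar_of_constants`, p155837) with the dyadic far sweep (F5 `farConditionalSweep`,
p156327), discharging the per-band hypotheses of the former from: the scale-free far-field bounds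
of the Kerr–Schild family (F3 `stub_kerrFarBandRegularity`, p154901), the far point multiplier
(F2b `stub_farPointMultiplier`, p155213 — `∂₀` is timelike far out), the far tube comparison (F6
`stub_kerrRadiusFarTube`, p155487), the universal exact-frame tolerance (UN-6a), the WEIGHTED
closeness `‖Dʲ(Φ^*g − g_{M,a})(z)‖ ≤ δ M / r^{j+1}` (exactly what the node's `FarSilentNearKerr`
gives through the chart package) and stationarity. Because everything is scale-free the handover
radius is `C · M` and the tolerance `δ` is a universal constant: no dependence on the label
window, none on the outer radius. Ionescu–Klainerman's `T`-conditional local extension theorem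
enters as the hypothesis `hIKC` (verbatim `Literature…IonescuKlainermanConditionalLocalExtension`).
-/

noncomputable section

set_option maxSynthPendingDepth 3

-- D-0017: single-problem summit, `Summit.<S>.<S>.…` by design (cf. lakefile `weak.linter.dupNamespace`).
set_option linter.dupNamespace false

namespace Summit.FinalStateConjecture.FinalStateConjecture.Theorems

open Set Function Metric
open Literature.Geometry.Lorentzian Literature.Geometry.Lorentzian.MetricCoord
open scoped Manifold ContDiff Topology ENNReal

/-- Registration handle (the main theorem's signature exceeds the 4000-character stub cap):
splitting of an iterated derivative of the chart components into the Kerr–Schild part and the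
deviation, `‖Dʲ G‖ ≤ ‖Dʲ g‖ + ‖Dʲ (G − g)‖` at a point of joint smoothness. [folklore] -/
theorem farChart_norm_iteratedFDeriv_le : ∀ (G g : E4 → E4 →L[ℝ] E4 →L[ℝ] ℝ) (z : E4) (j : ℕ),
    ContDiffAt ℝ j G z → ContDiffAt ℝ j g z →
    ‖iteratedFDeriv ℝ j G z‖ ≤ ‖iteratedFDeriv ℝ j g z‖ + ‖iteratedFDeriv ℝ j (fun y => G y - g y) z‖ := by
  intro G g z j hG hg
  have hD : ContDiffAt ℝ j (fun y => G y - g y) z := hG.sub hg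
  have hsplit : iteratedFDeriv ℝ j G z =
      iteratedFDeriv ℝ j g z + iteratedFDeriv ℝ j (fun y => G y - g y) z := by
    rw [← iteratedFDeriv_add_apply hg hD]
    congr 1
    funext y
    simp only [Pi.add_apply, add_sub_cancel]
  rw [hsplit]
  exact norm_add_le _ _

/-- **The far completion of the conditional sweep, chart level, universal constants.** There are
`C ≥ 16` and `δ > 0` such that for every label `0 < M`, `|a| < M`, every Ricci-flat spacetime and
every chart `Φ` (smooth, openly embedded, injective differential on `{r > M}`) whose components
are `δ`-close to `g_{M,a}` (`|a| ≤ χM`) in the WEIGHTED sense `‖Dʲ(Φ^*g − g_{M,a})(z)‖ ≤ δ M / r^{j+1}`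
(`j ≤ 6`) on `{r > M}` and STATIONARY beyond `C M / 4` (`Φ^*g (z + t∂₀) = Φ^*g (z)`), every
`C^∞` solution of the coordinate Killing equation on the collar `{C M/2 < r < C M}` commuting with
`∂₀` extends to one on `{r > C M/2}`, commuting with `∂₀` and agreeing with the datum on the
collar. Proof: F5 fed by V-6T-far, whose per-band hypotheses at the degenerate bands `[c, c]`,
`c ≥ C M`, come from F3 (far bounds), F2b (point multiplier, once `‖G − η‖ ≤ θ` and
`‖DG‖ ≤ θ/c`, i.e. `C ≥ (B+1)/θ`), F6 (tube) and UN-6a (frame).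
[cite: IonescuKlainerman2015, Thm 2.4] -/
theorem farChartExtension : ∀ (χ : ℝ), 0 ≤ χ → χ < 1 →
    (∀ (A A₁ δ₀ : ℝ), 1 ≤ A → A ≤ A₁ → 0 < δ₀ → δ₀ ≤ 1 → ∃ δ₁ : ℝ, 0 < δ₁ ∧ δ₁ ≤ δ₀ ∧
      ∀ (G : E4 → E4 →L[ℝ] E4 →L[ℝ] ℝ) (f : E4 → ℝ) (p τ : E4) (Z : E4 → E4),
        MetricCoord.IsMetricOn G (Metric.ball p 1) →
        (∀ x ∈ Metric.ball p 1, MetricCoord.ricAt G x = 0) →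
        G p = Minkowski.bilin →
        ContDiffOn ℝ ∞ f (Metric.ball p 1) →
        (∀ x ∈ Metric.ball p 1,
          (∑ j ∈ Finset.Icc 1 6, ‖iteratedFDeriv ℝ j G x‖) +
            (∑ j ∈ Finset.Icc 1 4, ‖iteratedFDeriv ℝ j f x‖) ≤ A) →
        f p = 0 → A₁⁻¹ ≤ ‖fderiv ℝ f p‖ →
        A₁⁻¹ ≤ ‖τ‖ → ‖τ‖ ≤ A₁ →
        (∀ x ∈ Metric.ball p 1, fderiv ℝ G x τ = 0) →
        (∀ x ∈ Metric.ball p 1, fderiv ℝ f x τ = 0) →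
        (∃ μ ∈ Icc (-A₁) A₁, ∀ X : E4,
          A₁⁻¹ * ‖X‖ ^ 2 ≤ μ * G p X X - MetricCoord.hessAt G f p X X +
            A₁ * ((fderiv ℝ f p X) ^ 2 + (G p τ X) ^ 2)) →
        ContDiffOn ℝ ∞ Z (Metric.ball p δ₀ ∩ {x | f x < 0}) →
        (∀ x ∈ Metric.ball p δ₀ ∩ {x | f x < 0}, ∀ Y W : E4,
          fderiv ℝ G x (Z x) Y W + G x (fderiv ℝ Z x Y) W + G x Y (fderiv ℝ Z x W) = 0) →
        (∀ x ∈ Metric.ball p δ₀ ∩ {x | f x < 0}, fderiv ℝ Z x τ = 0) →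
        ∃ Z' : E4 → E4, ContDiffOn ℝ ∞ Z' (Metric.ball p δ₁) ∧
          (∀ x ∈ Metric.ball p δ₁, ∀ Y W : E4,
            fderiv ℝ G x (Z' x) Y W + G x (fderiv ℝ Z' x Y) W + G x Y (fderiv ℝ Z' x W) = 0) ∧
          (∀ x ∈ Metric.ball p δ₁, fderiv ℝ Z' x τ = 0) ∧
          EqOn Z' Z (Metric.ball p δ₁ ∩ {x | f x < 0})) →
    ∃ (C δ : ℝ), 16 ≤ C ∧ 0 < δ ∧ ∀ (M a : ℝ), 0 < M → |a| ≤ χ * M →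
      ∀ (𝓢 : Spacetime.{0} 4) [𝓢.metric.HasLeviCivita] (Φ : E4 → 𝓢.carrier),
        𝓢.metric.toPseudoRiemannianMetric.IsRicciFlat →
        ContMDiffOn 𝓘(ℝ, E4) (𝓡 4) ∞ Φ {z | M < Kerr.radius a z} →
        Topology.IsOpenEmbedding ({z : E4 | M < Kerr.radius a z}.restrict Φ) →
        (∀ z : E4, M < Kerr.radius a z → Function.Injective (mfderiv 𝓘(ℝ, E4) (𝓡 4) Φ z)) →
        (∀ z : E4, M < Kerr.radius a z → ∀ j : ℕ, j ≤ 6 →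
          ‖iteratedFDeriv ℝ j (fun y => 𝓢.metricInCoords Φ y - Kerr.bilin M a y) z‖ ≤
            δ * M / Kerr.radius a z ^ (j + 1)) →
        (∀ z : E4, C * M / 4 ≤ Kerr.radius a z → ∀ t : ℝ,
          𝓢.metricInCoords Φ (z + t • E4.basisVector 0) = 𝓢.metricInCoords Φ z) →
        ∀ k₀ : E4 → E4,
          ContDiffOn ℝ ∞ k₀ {y | C * M / 2 < Kerr.radius a y ∧ Kerr.radius a y < C * M} →
          (∀ y ∈ {y : E4 | C * M / 2 < Kerr.radius a y ∧ Kerr.radius a y < C * M}, ∀ Y Z : E4,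
            fderiv ℝ (𝓢.metricInCoords Φ) y (k₀ y) Y Z + 𝓢.metricInCoords Φ y (fderiv ℝ k₀ y Y) Z
              + 𝓢.metricInCoords Φ y Y (fderiv ℝ k₀ y Z) = 0) →
          (∀ y ∈ {y : E4 | C * M / 2 < Kerr.radius a y ∧ Kerr.radius a y < C * M},
            fderiv ℝ k₀ y (E4.basisVector 0) = 0) →
          ∃ k : E4 → E4, ContDiffOn ℝ ∞ k {y | C * M / 2 < Kerr.radius a y} ∧
            (∀ y ∈ {y : E4 | C * M / 2 < Kerr.radius a y}, ∀ Y Z : E4,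
              fderiv ℝ (𝓢.metricInCoords Φ) y (k y) Y Z + 𝓢.metricInCoords Φ y (fderiv ℝ k y Y) Z
                + 𝓢.metricInCoords Φ y Y (fderiv ℝ k y Z) = 0) ∧
            (∀ y ∈ {y : E4 | C * M / 2 < Kerr.radius a y}, fderiv ℝ k y (E4.basisVector 0) = 0) ∧
            EqOn k k₀ {y | C * M / 2 < Kerr.radius a y ∧ Kerr.radius a y < C * M} := by
  intro χ hχ0 hχ1 hIKC
  -- universal constants: far bounds (F3), far point multiplier (F2b), frame (UN-6a), far step (F1)
  obtain ⟨Rs, CK, ν, hRs, hCK, hν, hfar⟩ := stub_kerrFarBandRegularity χ hχ0 hχ1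
  obtain ⟨θ, ε₁, hθ, hθ1, hε₁, hmult⟩ := stub_farPointMultiplier CK hCK
  obtain ⟨δF, hδF, hF⟩ := stub_ikFrameNormalisationU
  obtain ⟨ρf', hρf', hstep⟩ := ikLocalStepTFar_of_constants hIKC ε₁ ν CK δF (1 / 48) hε₁ hν hCK hδF
    (by norm_num) (by norm_num) (1 / 8) (by norm_num)
  -- the handover constant `C` and the universal tolerance `δ`
  obtain ⟨C, hC⟩ : ∃ C : ℝ, C = max (max 16 (4 * Rs)) ((CK + 1) / θ) := ⟨_, rfl⟩
  have hC16 : 16 ≤ C := by rw [hC]; exact (le_max_left _ _).trans (le_max_left _ _)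
  have hCRs : 4 * Rs ≤ C := by rw [hC]; exact (le_max_right _ _).trans (le_max_left _ _)
  have hCθ : (CK + 1) / θ ≤ C := by rw [hC]; exact le_max_right _ _
  have hCpos : 0 < C := by linarith
  obtain ⟨δ, hδ⟩ : ∃ δ : ℝ, δ = min 1 δF := ⟨_, rfl⟩
  have hδpos : 0 < δ := by rw [hδ]; exact lt_min one_pos hδF
  have hδ1 : δ ≤ 1 := by rw [hδ]; exact min_le_left _ _
  have hδF' : δ ≤ δF := by rw [hδ]; exact min_le_right _ _
  refine ⟨C, δ, hC16, hδpos, ?_⟩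
  intro M a hM haχ 𝓢 _ Φ hRF hΦ hemb hinjd hclose hstat k₀ hk₀ hkil₀ hinv₀
  have ha : |a| < M := lt_of_le_of_lt haχ (by nlinarith [abs_nonneg a])
  have haM : |a| ≤ M := ha.le
  have hrpM : Kerr.rPlus M a ≤ 2 * M := by
    have h := Real.sqrt_le_sqrt (show M ^ 2 - a ^ 2 ≤ M ^ 2 by nlinarith [sq_nonneg a])
    rw [Real.sqrt_sq hM.le] at h
    unfold Kerr.rPlus; linarith
  have hCM : 0 < C * M := mul_pos hCpos hM
  have h16 : 16 * M ≤ C * M := mul_le_mul_of_nonneg_right hC16 hM.le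
  have hRsM : Rs * M ≤ C * M / 4 := by
    have := mul_le_mul_of_nonneg_right hCRs hM.le
    linarith
  -- the chart components as a metric datum on `W = {r > M}`
  set G : E4 → E4 →L[ℝ] E4 →L[ℝ] ℝ := 𝓢.metricInCoords Φ with hGdef
  set W : Set E4 := {z | M < Kerr.radius a z} with hWdef
  have hW : IsOpen W := isOpen_lt continuous_const (Kerr.continuous_radius a)
  have hGmet : IsMetricOn G W := stub_isMetricOn_metricInCoords 𝓢 Φ W hW hΦ hinjd
  -- pointwise facts at far points `r z ≥ C M / 4` (≥ Rs M, > M)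
  have hfarz : ∀ z : E4, C * M / 4 ≤ Kerr.radius a z →
      M < Kerr.radius a z ∧ ContDiffAt ℝ ∞ (Kerr.bilin M a) z ∧ ContDiffAt ℝ ∞ (Kerr.radius a) z ∧
      ν ≤ ‖fderiv ℝ (Kerr.radius a) z‖ ∧ ‖fderiv ℝ (Kerr.radius a) z‖ ≤ CK ∧
      ‖Kerr.bilin M a z - Minkowski.bilin‖ ≤ CK * M / Kerr.radius a z ∧
      (∀ j : ℕ, 1 ≤ j → j ≤ 6 →
        ‖iteratedFDeriv ℝ j (Kerr.bilin M a) z‖ ≤ CK * M / Kerr.radius a z ^ (j + 1) ∧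
        ‖iteratedFDeriv ℝ j (Kerr.radius a) z‖ ≤ CK / Kerr.radius a z ^ (j - 1)) ∧
      (∀ j : ℕ, 1 ≤ j → j ≤ 6 →
        ‖iteratedFDeriv ℝ j G z‖ ≤ (CK + 1) * M / Kerr.radius a z ^ (j + 1)) := by
    intro z hz
    have hzRs : Rs * M ≤ Kerr.radius a z := hRsM.trans hz
    have hzM : M < Kerr.radius a z := by linarith
    obtain ⟨hcb, hcr, hνz, hDr, hg0, hgj⟩ := hfar M a hM haχ z hzRs
    refine ⟨hzM, hcb, hcr, hνz, hDr, hg0, hgj, fun j hj1 hj6 ↦ ?_⟩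
    have hGa : ContDiffAt ℝ j G z :=
      ((hGmet.contDiffOn z hzM).contDiffAt (hW.mem_nhds hzM)).of_le (by exact_mod_cast le_top)
    have hga : ContDiffAt ℝ j (Kerr.bilin M a) z := hcb.of_le (by exact_mod_cast le_top)
    have hr : 0 < Kerr.radius a z := hM.trans hzM
    calc ‖iteratedFDeriv ℝ j G z‖
        ≤ ‖iteratedFDeriv ℝ j (Kerr.bilin M a) z‖ +
            ‖iteratedFDeriv ℝ j (fun y => G y - Kerr.bilin M a y) z‖ :=
          farChart_norm_iteratedFDeriv_le G (Kerr.bilin M a) z j hGa hga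
      _ ≤ CK * M / Kerr.radius a z ^ (j + 1) + δ * M / Kerr.radius a z ^ (j + 1) :=
          add_le_add (hgj j hj1 hj6).1 (hclose z hzM j hj6)
      _ ≤ CK * M / Kerr.radius a z ^ (j + 1) + 1 * M / Kerr.radius a z ^ (j + 1) := by
          gcongr
      _ = (CK + 1) * M / Kerr.radius a z ^ (j + 1) := by ring
  -- the relative local step at every cylinder `c ≥ C M` (V-6T-far at the degenerate band `[c, c]`)
  have hstepC : ∀ c : ℝ, C * M ≤ c → ∀ x : E4, Kerr.radius a x = c → ∀ k : E4 → E4,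
      ContDiffOn ℝ ∞ k (ball x (1 / 8 * c) ∩ {y | Kerr.radius a y < c}) →
      (∀ y ∈ ball x (1 / 8 * c) ∩ {y | Kerr.radius a y < c}, ∀ Y Z : E4,
        fderiv ℝ G y (k y) Y Z + G y (fderiv ℝ k y Y) Z + G y Y (fderiv ℝ k y Z) = 0) →
      (∀ y ∈ ball x (1 / 8 * c) ∩ {y | Kerr.radius a y < c}, fderiv ℝ k y (E4.basisVector 0) = 0) →
      ∃ k' : E4 → E4, ContDiffOn ℝ ∞ k' (ball x (ρf' * c)) ∧
        (∀ y ∈ ball x (ρf' * c), ∀ Y Z : E4,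
          fderiv ℝ G y (k' y) Y Z + G y (fderiv ℝ k' y Y) Z + G y Y (fderiv ℝ k' y Z) = 0) ∧
        (∀ y ∈ ball x (ρf' * c), fderiv ℝ k' y (E4.basisVector 0) = 0) ∧
        EqOn k' k (ball x (ρf' * c) ∩ {y | Kerr.radius a y < c}) := by
    intro c hc x hx k hk hkil hkinv
    have hcpos : 0 < c := hCM.trans_le hc
    have hc16 : 16 * M ≤ c := h16.trans hc
    -- (FT): tube facts at relative radius `6 · (1/48) = 1/8`
    have hFT : ∀ z : E4, c ≤ Kerr.radius a z → Kerr.radius a z ≤ c → ∀ w : E4,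
        ‖w‖ ≤ 6 * (1 / 48) * Kerr.radius a z →
        M < Kerr.radius a (z + w) ∧ Kerr.radius a z / 2 ≤ Kerr.radius a (z + w) ∧
        ContDiffAt ℝ ∞ (Kerr.radius a) (z + w) ∧
        (∀ j : ℕ, 1 ≤ j → j ≤ 6 →
          ‖iteratedFDeriv ℝ j G (z + w)‖ ≤ (CK + 1) * M / Kerr.radius a (z + w) ^ (j + 1)) ∧
        (∀ j : ℕ, 1 ≤ j → j ≤ 4 →
          ‖iteratedFDeriv ℝ j (Kerr.radius a) (z + w)‖ ≤ CK / Kerr.radius a (z + w) ^ (j - 1)) ∧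
        (∀ t : ℝ, G (z + w + t • E4.basisVector 0) = G (z + w)) := by
      intro z hz1 hz2 w hw
      have hzc : Kerr.radius a z = c := le_antisymm hz2 hz1
      rw [hzc] at hw
      obtain ⟨hlow, -⟩ := stub_kerrRadiusFarTube M a z w haM
      rw [hzc] at hlow
      have hzw : C * M / 4 ≤ Kerr.radius a (z + w) := by linarith
      have hzw2 : c / 2 ≤ Kerr.radius a (z + w) := by linarith
      obtain ⟨hMzw, -, hcr, -, -, -, hgj, hGj⟩ := hfarz (z + w) hzw
      refine ⟨hMzw, by rw [hzc]; exact hzw2, hcr, hGj, fun j hj1 hj4 ↦ (hgj j hj1 (by omega)).2,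
        fun t ↦ hstat (z + w) hzw t⟩
    -- (FC) + (FM): order-0 closeness, non-degeneracy of `dr`, far point multiplier at band points
    have hPT : ∀ z : E4, c ≤ Kerr.radius a z → Kerr.radius a z ≤ c →
        ‖G z - Kerr.bilin M a z‖ ≤ δF ∧ ν ≤ ‖fderiv ℝ (Kerr.radius a) z‖ ∧
        ∃ μ : ℝ, |μ| ≤ ε₁⁻¹ ∧ ∀ w : E4,
          ε₁ ^ 2 * ‖w‖ ^ 2 ≤ μ * G z w w - Kerr.radius a z * hessAt G (Kerr.radius a) z w w
            + ε₁⁻¹ ^ 2 * ((G z (E4.basisVector 0) w) ^ 2 + (fderiv ℝ (Kerr.radius a) z w) ^ 2) := by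
      intro z hz1 hz2
      have hzc : Kerr.radius a z = c := le_antisymm hz2 hz1
      have hzC : C * M / 4 ≤ Kerr.radius a z := by rw [hzc]; linarith
      obtain ⟨hzM, hcb, -, hνz, hDr, hg0, hgj, hGj⟩ := hfarz z hzC
      have hr : 0 < Kerr.radius a z := hM.trans hzM
      -- order 0: `‖G − g‖ ≤ δ M / r ≤ δ ≤ δF`
      have hdev0 : ‖G z - Kerr.bilin M a z‖ ≤ δ * M / Kerr.radius a z := by
        have h := hclose z hzM 0 (Nat.zero_le _)
        rwa [norm_iteratedFDeriv_zero, zero_add, pow_one] at h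
      have hMr : M / Kerr.radius a z ≤ 1 := by rw [div_le_one hr]; exact hzM.le
      have hFC : ‖G z - Kerr.bilin M a z‖ ≤ δF := by
        calc ‖G z - Kerr.bilin M a z‖ ≤ δ * M / Kerr.radius a z := hdev0
          _ = δ * (M / Kerr.radius a z) := by ring
          _ ≤ δ * 1 := by gcongr
          _ ≤ δF := by linarith
      -- `‖G z − η‖ ≤ (CK + 1) M / r ≤ (CK + 1)/C ≤ θ`
      have hMrC : M / Kerr.radius a z ≤ 1 / C := by
        rw [div_le_div_iff₀ hr hCpos, one_mul, mul_comm, hzc]; linarith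
      have hθC : (CK + 1) / C ≤ θ := by
        have h := (div_le_iff₀ hθ).1 hCθ
        rw [div_le_iff₀ hCpos]
        linarith [mul_comm C θ]
      have hGη : ‖G z - Minkowski.bilin‖ ≤ θ := by
        calc ‖G z - Minkowski.bilin‖ ≤ ‖G z - Kerr.bilin M a z‖ + ‖Kerr.bilin M a z - Minkowski.bilin‖ :=
              norm_sub_le_norm_sub_add_norm_sub _ _ _
          _ ≤ δ * M / Kerr.radius a z + CK * M / Kerr.radius a z := add_le_add hdev0 hg0
          _ = (δ + CK) * (M / Kerr.radius a z) := by ring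
          _ ≤ (1 + CK) * (1 / C) := by gcongr
          _ = (CK + 1) / C := by ring
          _ ≤ θ := hθC
      -- `‖DG z‖ ≤ (CK + 1) M / r² = ((CK+1) M / r) / r ≤ θ / c`
      have hDG : ‖fderiv ℝ G z‖ ≤ θ / c := by
        have h1 := hGj 1 le_rfl (by norm_num)
        rw [norm_iteratedFDeriv_one] at h1
        have hMc : M / c ≤ 1 / C := by rw [← hzc]; exact hMrC
        have hkey : (CK + 1) * M / c ≤ θ := by
          calc (CK + 1) * M / c = (CK + 1) * (M / c) := by ring
            _ ≤ (CK + 1) * (1 / C) := by gcongr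
            _ = (CK + 1) / C := by ring
            _ ≤ θ := hθC
        have h2 : (CK + 1) * M / Kerr.radius a z ^ (1 + 1) ≤ θ / c := by
          rw [hzc, show (1 + 1 : ℕ) = 2 from rfl, pow_two, ← div_div]
          exact div_le_div_of_nonneg_right hkey hcpos.le
        exact h1.trans h2
      -- `‖D² r‖ ≤ CK / r`
      have hD2r : ‖iteratedFDeriv ℝ 2 (Kerr.radius a) z‖ ≤ CK / c := by
        have h := (hgj 2 (by norm_num) (by norm_num)).2
        rwa [show (2 : ℕ) - 1 = 1 from rfl, pow_one, hzc] at h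
      obtain ⟨μ, hμ, hmul⟩ := hmult G W a c z hGmet hzM hzc hcpos hDr hD2r hGη hDG
      refine ⟨hFC, hνz, μ, hμ, fun w ↦ ?_⟩
      have h := hmul w
      rwa [hzc]
    -- V-6T-far at the label and the degenerate band `[c, c]`
    have hband := hstep M a c c hM ha (by linarith) (by linarith) le_rfl (hF M a hM) 𝓢 Φ hRF hΦ
      hemb hinjd hFT hPT
    exact hband c ⟨le_rfl, le_rfl⟩ x hx k hk hkil hkinv
  -- F5: the dyadic far sweep from the collar `{C M / 2 < r < C M}`
  have hWsub : {y : E4 | C * M / 4 < Kerr.radius a y} ⊆ W := by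
    intro y hy; show M < Kerr.radius a y
    have hy' : C * M / 4 < Kerr.radius a y := hy
    linarith
  exact farConditionalSweep G W a M (C * M) (1 / 8) (min (1 / 8) ρf') (E4.basisVector 0) k₀ hGmet hM.le
    haM hCM h16 (by norm_num) le_rfl (lt_min (by norm_num) hρf') (min_le_left _ _) hWsub
    (fun c hc x hx k hk hkil hkinv ↦ by
      obtain ⟨k', h1, h2, h3, h4⟩ := hstepC c hc x hx k hk hkil hkinv
      have hsub : ball x (min (1 / 8) ρf' * c) ⊆ ball x (ρf' * c) :=
        ball_subset_ball (mul_le_mul_of_nonneg_right (min_le_right _ _) (hCM.trans_le hc).le)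
      exact ⟨k', h1.mono hsub, fun y hy ↦ h2 y (hsub hy), fun y hy ↦ h3 y (hsub hy),
        h4.mono (inter_subset_inter_left _ hsub)⟩)
    hk₀ hkil₀ hinv₀

end Summit.FinalStateConjecture.FinalStateConjecture.Theorems

end
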